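import Summits.ResolutionOfSingularities.ResolutionOfSingularities.Theorems.EquisingularLiftEquisingularLiftNatTcDeltaPointResolutionDim
import Summits.ResolutionOfSingularities.ResolutionOfSingularities.Theorems.EquisingularLiftEquisingularLiftNatCarrierDeltaHDeltaTC3
import HarnessLib

/-!
# EL♮ / line w45b — the CLOSED n = 3 instance of the registered tangent-cone Δ-step stub

`stub_elnat_tcDeltaPointResolution_three` = the REGISTERED stub text
`stub_elnat_tcDeltaPointResolution` (skeleton v5.1 on stmt-ResolutionOfSingularities-20038,
res-L1-w45b-lead-2 `TARGET-T-ISO-0PLUS.lean` sha16 f6dcd08c24429701) with ONE hypothesis `n = 3 →`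
inserted right after the locally-principal clause, proved outright:
`subst` + T-INST₂ `stub_elnat_tcDeltaPointResolution_of_carrierLift_dim` (res-D-pv-029, p521291)
+ the supplier theorem HΔTC₃ `exists_carrierDelta_of_admTC_three` (res-type-100) which discharges
the lift hypothesis HΔ(AdmTC)-with-`ringKrullDim … = ((3 + 1 : ℕ) : WithBot ℕ∞)` verbatim.

HONEST FRAMING: OURS (HIRONAKA-L lane, chain w45b), not a statement of any manuscript; a helper
`--supports stmt-ResolutionOfSingularities-20038`, not the registered stub name (the lead reshapes
the skeleton so that the n = 3 branch calls this theorem).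
-/

set_option linter.dupNamespace false -- mandated namespace `Summit.<Summit>.<Problem>` of this single-conjunct summit

namespace Summit.ResolutionOfSingularities.ResolutionOfSingularities.Cruxes.EquisingularLiftNat.Sections

open CategoryTheory AlgebraicGeometry

/-- **EL♮(3), tangent-cone Δ-step rung, CLOSED.** The registered stub text
`stub_elnat_tcDeltaPointResolution` (v5.1, sha16 f6dcd08c24429701) with the single extra hypothesis
`n = 3`: for a prime `p`, an algebraically closed field `k` of characteristic `p`, an integral
hypersurface `H ⊆ ℙ³_k` (locally principal ideal), every downstairs point-resolution datum closed
under good-point blow-ups (P) and tangent-cone Δ-steps (TC) with regular end `V(closure T')_red`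
lifts: there is a complete DVR `O` of characteristic zero with `O ↠ k` such that for every graded
lift `φ` of `MvPolynomial.map π` the chain predicate upstairs over `Proj O[x₀..x₃]` reaches a
regular `V(closure S')_red`. Proof: `subst n = 3`, then T-INST₂
`stub_elnat_tcDeltaPointResolution_of_carrierLift_dim` fed with res-type-100's HΔTC₃
`exists_carrierDelta_of_admTC_three k`. OURS, not a statement of any manuscript. -/
theorem stub_elnat_tcDeltaPointResolution_three (p : ℕ) : p.Prime → ∀ (k : Type) [Field k] [CharP k p] [IsAlgClosed k] (n : ℕ) (H : AlgebraicGeometry.Scheme.{0}) (ι : H ⟶ (Literature.AlgebraicGeometry.Motives.projectiveSpace n k).left), AlgebraicGeometry.IsClosedImmersion ι → AlgebraicGeometry.IsIntegral H → (∀ y : (Literature.AlgebraicGeometry.Motives.projectiveSpace n k).left, ∃ U : (Literature.AlgebraicGeometry.Motives.projectiveSpace n k).left.affineOpens, y ∈ (U : (Literature.AlgebraicGeometry.Motives.projectiveSpace n k).left.Opens) ∧ (ι.ker.ideal U).IsPrincipal) → n = 3 → (∃ (F' : AlgebraicGeometry.Scheme.{0}) (ρ' : F' ⟶ (Literature.AlgebraicGeometry.Motives.projectiveSpace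 n k).left) (T' : Set F'), (∀ Q : (∀ F₁ : AlgebraicGeometry.Scheme.{0}, (F₁ ⟶ (Literature.AlgebraicGeometry.Motives.projectiveSpace n k).left) → Set F₁ → Prop), Q (Literature.AlgebraicGeometry.Motives.projectiveSpace n k).left (CategoryTheory.CategoryStruct.id (Literature.AlgebraicGeometry.Motives.projectiveSpace n k).left) (Set.range ι) → (∀ (F₁ F₂ : AlgebraicGeometry.Scheme.{0}) (ρ : F₁ ⟶ (Literature.AlgebraicGeometry.Motives.projectiveSpace n k).left) (T₁ : Set F₁) (x : ↥(AlgebraicGeometry.Scheme.IdealSheafData.vanishingIdeal (⟨closure T₁, isClosed_closure⟩ : TopologicalSpace.Closeds F₁)).subscheme) (υ : F₂ ⟶ F₁) (hx : IsClosed ({((AlgebraicGeometry.Scheme.IdealSheafData.vanishingIdeal (⟨closure T₁, isClosed_closure⟩ : TopologicalSpace.Closeds F₁)).subschemeι x : F₁)} : Set F₁)), Q F₁ ρ T₁ → ¬ IsRegularLocalRing ((AlgebraicGeometry.Scheme.IdealSheafData.vanishingIdeal (⟨closure T₁, isClosed_closure⟩ : TopologicalSpace.Closeds F₁)).subscheme.presheaf.stalk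 x) → IsRegularLocalRing (F₁.presheaf.stalk (((AlgebraicGeometry.Scheme.IdealSheafData.vanishingIdeal (⟨closure T₁, isClosed_closure⟩ : TopologicalSpace.Closeds F₁))).subschemeι x : F₁)) → Literature.AlgebraicGeometry.Resolution.IsBlowup υ (AlgebraicGeometry.Scheme.IdealSheafData.vanishingIdeal (⟨{((AlgebraicGeometry.Scheme.IdealSheafData.vanishingIdeal (⟨closure T₁, isClosed_closure⟩ : TopologicalSpace.Closeds F₁)).subschemeι x : F₁)}, hx⟩ : TopologicalSpace.Closeds F₁)) → Q F₂ (CategoryTheory.CategoryStruct.comp υ ρ) (closure (υ ⁻¹' (T₁ \ {((AlgebraicGeometry.Scheme.IdealSheafData.vanishingIdeal (⟨closure T₁, isClosed_closure⟩ : TopologicalSpace.Closeds F₁)).subschemeι x : F₁)})))) → (∀ (F₁ F₂ F₃ : AlgebraicGeometry.Scheme.{0}) (ρ : F₁ ⟶ (Literature.AlgebraicGeometry.Motives.projectiveSpace n k).left) (T₁ : Set F₁) (x : ↥((AlgebraicGeometry.Scheme.IdealSheafData.vanishingIdeal (⟨closure T₁, isClosed_closure⟩ : TopologicalSpace.Closeds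 F₁))).subscheme) (υ : F₂ ⟶ F₁) (hx : IsClosed ({(((AlgebraicGeometry.Scheme.IdealSheafData.vanishingIdeal (⟨closure T₁, isClosed_closure⟩ : TopologicalSpace.Closeds F₁))).subschemeι x : F₁)} : Set F₁)) (W : Set F₁) (υ' : F₃ ⟶ F₂) (hZ : IsClosed (υ ⁻¹' {(((AlgebraicGeometry.Scheme.IdealSheafData.vanishingIdeal (⟨closure T₁, isClosed_closure⟩ : TopologicalSpace.Closeds F₁))).subschemeι x : F₁)} ∩ closure (υ ⁻¹' (W \ {(((AlgebraicGeometry.Scheme.IdealSheafData.vanishingIdeal (⟨closure T₁, isClosed_closure⟩ : TopologicalSpace.Closeds F₁))).subschemeι x : F₁)})))), Q F₁ ρ T₁ → ¬ IsRegularLocalRing (((AlgebraicGeometry.Scheme.IdealSheafData.vanishingIdeal (⟨closure T₁, isClosed_closure⟩ : TopologicalSpace.Closeds F₁))).subscheme.presheaf.stalk x) → IsRegularLocalRing (F₁.presheaf.stalk (((AlgebraicGeometry.Scheme.IdealSheafData.vanishingIdeal (⟨closure T₁, isClosed_closure⟩ : TopologicalSpace.Closeds F₁))).subschemeι x : F₁))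 → Literature.AlgebraicGeometry.Resolution.IsBlowup υ (AlgebraicGeometry.Scheme.IdealSheafData.vanishingIdeal (⟨{(((AlgebraicGeometry.Scheme.IdealSheafData.vanishingIdeal (⟨closure T₁, isClosed_closure⟩ : TopologicalSpace.Closeds F₁))).subschemeι x : F₁)}, hx⟩ : TopologicalSpace.Closeds F₁)) → (((AlgebraicGeometry.Scheme.IdealSheafData.vanishingIdeal (⟨closure T₁, isClosed_closure⟩ : TopologicalSpace.Closeds F₁))).subschemeι x : F₁) ∈ W → ¬ (υ ⁻¹' {(((AlgebraicGeometry.Scheme.IdealSheafData.vanishingIdeal (⟨closure T₁, isClosed_closure⟩ : TopologicalSpace.Closeds F₁))).subschemeι x : F₁)} ⊆ closure (υ ⁻¹' (W \ {(((AlgebraicGeometry.Scheme.IdealSheafData.vanishingIdeal (⟨closure T₁, isClosed_closure⟩ : TopologicalSpace.Closeds F₁))).subschemeι x : F₁)}))) → (∃ U : F₁.affineOpens, (((AlgebraicGeometry.Scheme.IdealSheafData.vanishingIdeal (⟨closure T₁, isClosed_closure⟩ : TopologicalSpace.Closeds F₁))).subschemeι x : F₁) ∈ (U : F₁.Opens)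 ∧ ((AlgebraicGeometry.Scheme.IdealSheafData.vanishingIdeal (⟨closure W, isClosed_closure⟩ : TopologicalSpace.Closeds F₁)).ideal U).IsPrincipal) → (υ ⁻¹' {(((AlgebraicGeometry.Scheme.IdealSheafData.vanishingIdeal (⟨closure T₁, isClosed_closure⟩ : TopologicalSpace.Closeds F₁))).subschemeι x : F₁)} ∩ closure (υ ⁻¹' (W \ {(((AlgebraicGeometry.Scheme.IdealSheafData.vanishingIdeal (⟨closure T₁, isClosed_closure⟩ : TopologicalSpace.Closeds F₁))).subschemeι x : F₁)}))) ⊆ closure (υ ⁻¹' (T₁ \ {(((AlgebraicGeometry.Scheme.IdealSheafData.vanishingIdeal (⟨closure T₁, isClosed_closure⟩ : TopologicalSpace.Closeds F₁))).subschemeι x : F₁)})) → ¬ (closure (υ ⁻¹' (T₁ \ {(((AlgebraicGeometry.Scheme.IdealSheafData.vanishingIdeal (⟨closure T₁, isClosed_closure⟩ : TopologicalSpace.Closeds F₁))).subschemeι x : F₁)})) ⊆ (υ ⁻¹' {(((AlgebraicGeometry.Scheme.IdealSheafData.vanishingIdeal (⟨closure T₁, isClosed_closure⟩ : TopologicalSpace.Closeds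 F₁))).subschemeι x : F₁)} ∩ closure (υ ⁻¹' (W \ {(((AlgebraicGeometry.Scheme.IdealSheafData.vanishingIdeal (⟨closure T₁, isClosed_closure⟩ : TopologicalSpace.Closeds F₁))).subschemeι x : F₁)})))) → Set.Finite {z : ↥((AlgebraicGeometry.Scheme.IdealSheafData.vanishingIdeal (⟨(υ ⁻¹' {(((AlgebraicGeometry.Scheme.IdealSheafData.vanishingIdeal (⟨closure T₁, isClosed_closure⟩ : TopologicalSpace.Closeds F₁))).subschemeι x : F₁)} ∩ closure (υ ⁻¹' (W \ {(((AlgebraicGeometry.Scheme.IdealSheafData.vanishingIdeal (⟨closure T₁, isClosed_closure⟩ : TopologicalSpace.Closeds F₁))).subschemeι x : F₁)}))), hZ⟩ : TopologicalSpace.Closeds F₂))).subscheme | ¬ IsRegularLocalRing (((AlgebraicGeometry.Scheme.IdealSheafData.vanishingIdeal (⟨(υ ⁻¹' {(((AlgebraicGeometry.Scheme.IdealSheafData.vanishingIdeal (⟨closure T₁, isClosed_closure⟩ : TopologicalSpace.Closeds F₁))).subschemeι x : F₁)} ∩ closure (υ ⁻¹' (W \ {(((AlgebraicGeometry.Scheme.IdealSheafData.vanishingIdeal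 (⟨closure T₁, isClosed_closure⟩ : TopologicalSpace.Closeds F₁))).subschemeι x : F₁)}))), hZ⟩ : TopologicalSpace.Closeds F₂))).subscheme.presheaf.stalk z)} → Literature.AlgebraicGeometry.Resolution.IsBlowup υ' (AlgebraicGeometry.Scheme.IdealSheafData.vanishingIdeal (⟨(υ ⁻¹' {(((AlgebraicGeometry.Scheme.IdealSheafData.vanishingIdeal (⟨closure T₁, isClosed_closure⟩ : TopologicalSpace.Closeds F₁))).subschemeι x : F₁)} ∩ closure (υ ⁻¹' (W \ {(((AlgebraicGeometry.Scheme.IdealSheafData.vanishingIdeal (⟨closure T₁, isClosed_closure⟩ : TopologicalSpace.Closeds F₁))).subschemeι x : F₁)}))), hZ⟩ : TopologicalSpace.Closeds F₂)) → Q F₃ (CategoryTheory.CategoryStruct.comp (CategoryTheory.CategoryStruct.comp υ' υ) ρ) (closure (υ' ⁻¹' (closure (υ ⁻¹' (T₁ \ {(((AlgebraicGeometry.Scheme.IdealSheafData.vanishingIdeal (⟨closure T₁, isClosed_closure⟩ : TopologicalSpace.Closeds F₁))).subschemeι x : F₁)})) \ (υ ⁻¹' {(((AlgebraicGeometry.Scheme.IdealSheafData.vanishingIdeal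 (⟨closure T₁, isClosed_closure⟩ : TopologicalSpace.Closeds F₁))).subschemeι x : F₁)} ∩ closure (υ ⁻¹' (W \ {(((AlgebraicGeometry.Scheme.IdealSheafData.vanishingIdeal (⟨closure T₁, isClosed_closure⟩ : TopologicalSpace.Closeds F₁))).subschemeι x : F₁)}))))))) → Q F' ρ' T') ∧ Literature.AlgebraicGeometry.Resolution.Scheme.IsRegular (AlgebraicGeometry.Scheme.IdealSheafData.vanishingIdeal (⟨closure T', isClosed_closure⟩ : TopologicalSpace.Closeds F')).subscheme) → ∃ (O : Type) (_ : CommRing O) (_ : IsDomain O) (_ : IsDiscreteValuationRing O) (_ : CharZero O) (π : O →+* k), Function.Surjective π ∧ (letI := MvPolynomial.gradedAlgebra (σ := Fin (n + 1)) (R := O); letI := MvPolynomial.gradedAlgebra (σ := Fin (n + 1)) (R := k); ∀ (φ : MvPolynomial.homogeneousSubmodule (Fin (n + 1)) O →+*ᵍ MvPolynomial.homogeneousSubmodule (Fin (n + 1)) k) (hφ' : HomogeneousIdeal.irrelevant (MvPolynomial.homogeneousSubmodule (Fin (n + 1)) k) ≤ (HomogeneousIdeal.irrelevant (MvPolynomial.homogeneousSubmodule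 (Fin (n + 1)) O)).map φ), (∀ s, φ s = MvPolynomial.map π s) → ∀ Y : Set (AlgebraicGeometry.Proj (MvPolynomial.homogeneousSubmodule (Fin (n + 1)) O)), Y = Set.range (CategoryTheory.CategoryStruct.comp ι (AlgebraicGeometry.Proj.map φ hφ') : H ⟶ (AlgebraicGeometry.Proj (MvPolynomial.homogeneousSubmodule (Fin (n + 1)) O))) → ∃ (P' : AlgebraicGeometry.Scheme.{0}) (σ : P' ⟶ (AlgebraicGeometry.Proj (MvPolynomial.homogeneousSubmodule (Fin (n + 1)) O))) (S' : Set P'), (∀ Q : (∀ X' : AlgebraicGeometry.Scheme.{0}, (X' ⟶ (AlgebraicGeometry.Proj (MvPolynomial.homogeneousSubmodule (Fin (n + 1)) O))) → Set X' → Prop), Q (AlgebraicGeometry.Proj (MvPolynomial.homogeneousSubmodule (Fin (n + 1)) O)) (CategoryTheory.CategoryStruct.id (AlgebraicGeometry.Proj (MvPolynomial.homogeneousSubmodule (Fin (n + 1)) O))) Y → (∀ (X' X'' : AlgebraicGeometry.Scheme.{0}) (σ' : X' ⟶ (AlgebraicGeometry.Proj (MvPolynomial.homogeneousSubmodule (Fin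 (n + 1)) O))) (Y' : Set X') (C : X'.IdealSheafData) (τ : X'' ⟶ X'), Q X' σ' Y' → Literature.AlgebraicGeometry.Resolution.IsBlowup τ C → Literature.AlgebraicGeometry.Resolution.Scheme.IsRegular C.subscheme → AlgebraicGeometry.Flat (CategoryTheory.CategoryStruct.comp C.subschemeι (CategoryTheory.CategoryStruct.comp σ' (CategoryTheory.CategoryStruct.comp (AlgebraicGeometry.Proj.toSpecZero (MvPolynomial.homogeneousSubmodule (Fin (n + 1)) O)) (AlgebraicGeometry.Spec.map (CommRingCat.ofHom (algebraMap O (MvPolynomial.homogeneousSubmodule (Fin (n + 1)) O 0))))))) → σ' '' (C.support : Set X') ⊆ {x | ¬ IsGenericPoint x Y} → (C.support : Set X') ∩ (CategoryTheory.CategoryStruct.comp σ' (CategoryTheory.CategoryStruct.comp (AlgebraicGeometry.Proj.toSpecZero (MvPolynomial.homogeneousSubmodule (Fin (n + 1)) O)) (AlgebraicGeometry.Spec.map (CommRingCat.ofHom (algebraMap O (MvPolynomial.homogeneousSubmodule (Fin (n + 1)) O 0)))))) ⁻¹' {IsLocalRing.closedPoint O} ⊆ Y' → Q X'' (CategoryTheory.CategoryStruct.comp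 τ σ') (closure (τ ⁻¹' (Y' \ (C.support : Set X'))))) → Q P' σ S') ∧ Literature.AlgebraicGeometry.Resolution.Scheme.IsRegular (AlgebraicGeometry.Scheme.IdealSheafData.vanishingIdeal (⟨closure S', isClosed_closure⟩ : TopologicalSpace.Closeds P')).subscheme) := by
  intro hp k _ _ _ n H ι hι hH hpr hn hres
  subst hn
  exact stub_elnat_tcDeltaPointResolution_of_carrierLift_dim p hp k 3 H ι hι hH hpr
    (exists_carrierDelta_of_admTC_three k) hres

end Summit.ResolutionOfSingularities.ResolutionOfSingularities.Cruxes.EquisingularLiftNat.Sections
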